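import Summits.CriticalPhenomena.PercolationContinuityZ3.Theorems.PercNearOneGluingNoHeavyLowerTailAttachedChampionObserverExchange
import HarnessLib

/-!
# `NoHeavyLowerTail` (stmt-CriticalPhenomena-4575) — the attached-champion inequality XZ in the EASY REGIME
# (observer no lonelier than the champion), for every attachment set and every number of hull ports

Support file (prover `prim-hp-4`, hull-port prover #4, LP-duality technique; `--supports stmt-CriticalPhenomena-4575`).
No definitions, no named facts, no sorries.

Notation of `…AttachedChampionObserverExchange.lean`: `μ = prodBernoulli w` on `Fin n`, relays `A`, level `j`,
`M_x = |{a ∈ A : x ↔ a}|`, observer `o` with `N = M_o`, and for a finite vertex set `S` the ATTACHMENT EVENT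
`{o ↔ S} = ⋃_{a ∈ S} {o ↔ a}`.

The registered residual `stub_attachedChampion` (XZ) reads `μ(1 ≤ N ≤ j) ≤ μ(M_q ≤ j ∧ 1 ≤ N)` for a level-`j`
champion `q`; it is proved in the tree for `j = 1`, `j ≥ |A| − 2`, relay-neighboured observers and two gates, and open from
three hull ports on.  In the LP-duality analysis of the hull-port residual (this seat) the attached-champion rows are the
bilinear rows of the certificate; the present file adds the row CENTRED AT THE OBSERVER:

* `attachedSet_row` (**ROW-O**, champion-free, any vertices `o, q`, any finite `S`):
  `μ(o ↔ S, N ≤ j < M_q) · μ(M_q ≤ j < N) ≤ μ(o ↔ S, M_q ≤ j < N) · μ(N ≤ j < M_q)` — verbatim the two-cluster exchange of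
  van den Berg–Häggström–Kahn (2006, Thm. 1.5; the tree's `setTwoClusterExchange` with `S = {o}`, `T = {q}`): `{o ↔ S}` and
  `{N > j, M_q ≤ j}` are of type `(+)` for the pair `(C_o, C_q)`, `{N ≤ j, M_q > j}` of type `(−)`.
* `attachedSet_le_of_notLonelier`: if `μ(N ≤ j) ≤ μ(M_q ≤ j)` then `μ(o ↔ S, N ≤ j) ≤ μ(o ↔ S, M_q ≤ j)` for EVERY `S`.
* `attachedSet_sub_le` (deficiency form, no hypothesis): `μ(o ↔ S, N ≤ j) − μ(o ↔ S, M_q ≤ j) ≤ (μ(N ≤ j) − μ(M_q ≤ j))⁺`.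
* `attachedChampion_of_notLonelier` — **XZ in the easy regime**: for every weighted graph, every `A`, `o`, `q`, `j` with
  `μ(N ≤ j) ≤ μ(M_q ≤ j)` (the observer, counted without itself, is no lonelier than `q`),
  `μ(1 ≤ N ≤ j) ≤ μ(M_q ≤ j ∧ 1 ≤ N)` — the conclusion of `stub_attachedChampion`, with no assumption on the hull of `o`
  and no championship needed.  Hence the hull-port residual (any number of ports) lives entirely in the HARD REGIME
  `μ(N ≤ j) > μ(M_q ≤ j)` (the observer is lonelier than the champion, e.g. because it is often unattached: `{N ≤ j} ⊇ {N = 0}`),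
  and there XZ fails by at most the loneliness excess `μ(N ≤ j) − μ(M_q ≤ j)` (`attachedSet_sub_le` with `S = A`).
-/

noncomputable section

namespace Summit.CriticalPhenomena.PercolationContinuityZ3.Theorems

open MeasureTheory Set Literature.Probability.LatticeModels Literature.Probability.Percolation
open scoped Classical BigOperators

variable {n : ℕ}

namespace AttachedChampionNotLonelier

open AttachedChampionObserverExchange

/-- **ROW-O, raw form** (`setTwoClusterExchange` with `S = {o}`, `T = {q}`): with `D = {o ↮ q}`, `E = {o ↔ S}`,
`X = {N ≤ j < M_q}`, `Y = {M_q ≤ j < N}`: `μ(D ∩ (E ∩ X)) · μ(D ∩ (Y ∩ univ)) ≤ μ(D ∩ (E ∩ Y)) · μ(D ∩ (X ∩ univ))`.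
[derived from: VandenbergHaggstromKahn2005, Thm. 1.5, via `setTwoClusterExchange`] -/
theorem attachedSet_row_raw (w : Sym2 (Fin n) → unitInterval) (A S : Finset (Fin n)) (o q : Fin n) (j : ℕ) :
    (prodBernoulli w).real ({ω : BondConfig (Fin n) | ∀ s ∈ ({o} : Set (Fin n)), ∀ t ∈ ({q} : Set (Fin n)),
          ¬ (openGraph ω).Reachable s t} ∩
        ((⋃ a ∈ S, (openConn o a : Set (BondConfig (Fin n)))) ∩
          {ω | (A.filter fun x => ω ∈ openConn o x).card ≤ j ∧ j < (A.filter fun x => ω ∈ openConn q x).card})) *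
      (prodBernoulli w).real ({ω : BondConfig (Fin n) | ∀ s ∈ ({o} : Set (Fin n)), ∀ t ∈ ({q} : Set (Fin n)),
          ¬ (openGraph ω).Reachable s t} ∩
        ({ω | j < (A.filter fun x => ω ∈ openConn o x).card ∧ (A.filter fun x => ω ∈ openConn q x).card ≤ j} ∩
          univ)) ≤
    (prodBernoulli w).real ({ω : BondConfig (Fin n) | ∀ s ∈ ({o} : Set (Fin n)), ∀ t ∈ ({q} : Set (Fin n)),
          ¬ (openGraph ω).Reachable s t} ∩
        ((⋃ a ∈ S, (openConn o a : Set (BondConfig (Fin n)))) ∩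
          {ω | j < (A.filter fun x => ω ∈ openConn o x).card ∧ (A.filter fun x => ω ∈ openConn q x).card ≤ j})) *
      (prodBernoulli w).real ({ω : BondConfig (Fin n) | ∀ s ∈ ({o} : Set (Fin n)), ∀ t ∈ ({q} : Set (Fin n)),
          ¬ (openGraph ω).Reachable s t} ∩
        ({ω | (A.filter fun x => ω ∈ openConn o x).card ≤ j ∧ j < (A.filter fun x => ω ∈ openConn q x).card} ∩
          univ)) := by
  have ho : o ∈ ({o} : Set (Fin n)) := mem_singleton o
  have hq : q ∈ ({q} : Set (Fin n)) := mem_singleton q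
  refine setTwoClusterExchange w ({o} : Set (Fin n)) ({q} : Set (Fin n)) ?_ ?_ ?_ ?_
  · -- `{o ↔ S}` is of type (+)
    intro ω ω' hs ht h
    obtain ⟨a, ha, hωa⟩ := mem_iUnion₂.1 h
    exact mem_iUnion₂.2 ⟨a, ha, TwoSetExchange.typePlus_openConn_of_mem _ _ ho a hs ht hωa⟩
  · -- `{N > j, M_q ≤ j}` is of type (+)
    intro ω ω' hs ht h
    refine ⟨lt_of_lt_of_le h.1 (card_filter_mono A fun x _ hx => ?_),
      le_trans (card_filter_mono A fun x _ hx => ?_) h.2⟩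
    · exact TwoSetExchange.typePlus_openConn_of_mem _ _ ho x hs ht hx
    · by_contra h0
      exact (TwoSetExchange.typePlus_not_openConn_of_mem ({o} : Set (Fin n)) _ hq x hs ht h0) hx
  · -- `{N ≤ j, M_q > j}` is of type (−)
    intro ω ω' hs ht h
    refine ⟨le_trans (card_filter_mono A fun x _ hx => ?_) h.1,
      lt_of_lt_of_le h.2 (card_filter_mono A fun x _ hx => ?_)⟩
    · by_contra h0
      exact (TwoSetExchange.typeMinus_not_openConn_of_mem _ ({q} : Set (Fin n)) ho x hs ht h0) hx
    · exact TwoSetExchange.typeMinus_openConn_of_mem ({o} : Set (Fin n)) _ hq x hs ht hx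
  · -- `univ` is of type (−)
    intro ω ω' _ _ _
    exact mem_univ _

/-- **ROW-O (observer-centred exchange row, champion-free).**  For any vertices `o, q`, finite `S`, relays `A`,
level `j`: `μ(o ↔ S, N ≤ j < M_q) · μ(M_q ≤ j < N) ≤ μ(o ↔ S, M_q ≤ j < N) · μ(N ≤ j < M_q)`.
[derived from: VandenbergHaggstromKahn2005, Thm. 1.5 (two-cluster exchange), via `setTwoClusterExchange`] -/
theorem attachedSet_row (w : Sym2 (Fin n) → unitInterval) (A S : Finset (Fin n)) (o q : Fin n) (j : ℕ) :
    (prodBernoulli w).real ((⋃ a ∈ S, (openConn o a : Set (BondConfig (Fin n)))) ∩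
        {ω | (A.filter fun x => ω ∈ openConn o x).card ≤ j ∧ j < (A.filter fun x => ω ∈ openConn q x).card}) *
      (prodBernoulli w).real
        {ω : BondConfig (Fin n) | j < (A.filter fun x => ω ∈ openConn o x).card ∧
          (A.filter fun x => ω ∈ openConn q x).card ≤ j} ≤
    (prodBernoulli w).real ((⋃ a ∈ S, (openConn o a : Set (BondConfig (Fin n)))) ∩
        {ω | j < (A.filter fun x => ω ∈ openConn o x).card ∧ (A.filter fun x => ω ∈ openConn q x).card ≤ j}) *
      (prodBernoulli w).real
        {ω : BondConfig (Fin n) | (A.filter fun x => ω ∈ openConn o x).card ≤ j ∧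
          j < (A.filter fun x => ω ∈ openConn q x).card} := by
  have key := attachedSet_row_raw w A S o q j
  rw [inter_univ, inter_univ] at key
  have hX : ∀ ω ∈ ((⋃ a ∈ S, (openConn o a : Set (BondConfig (Fin n)))) ∩
      {ω | (A.filter fun x => ω ∈ openConn o x).card ≤ j ∧ j < (A.filter fun x => ω ∈ openConn q x).card}),
      (A.filter fun x => ω ∈ openConn o x).card ≠ (A.filter fun x => ω ∈ openConn q x).card :=
    fun ω h heq => absurd (heq ▸ h.2.1) (not_le.2 h.2.2)
  have hY : ∀ ω ∈ {ω : BondConfig (Fin n) | j < (A.filter fun x => ω ∈ openConn o x).card ∧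
      (A.filter fun x => ω ∈ openConn q x).card ≤ j},
      (A.filter fun x => ω ∈ openConn o x).card ≠ (A.filter fun x => ω ∈ openConn q x).card :=
    fun ω h heq => absurd (heq ▸ h.1) (not_lt.2 h.2)
  have hX' : ∀ ω ∈ ((⋃ a ∈ S, (openConn o a : Set (BondConfig (Fin n)))) ∩
      {ω | j < (A.filter fun x => ω ∈ openConn o x).card ∧ (A.filter fun x => ω ∈ openConn q x).card ≤ j}),
      (A.filter fun x => ω ∈ openConn o x).card ≠ (A.filter fun x => ω ∈ openConn q x).card :=
    fun ω h => hY ω h.2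
  have hY' : ∀ ω ∈ {ω : BondConfig (Fin n) | (A.filter fun x => ω ∈ openConn o x).card ≤ j ∧
      j < (A.filter fun x => ω ∈ openConn q x).card},
      (A.filter fun x => ω ∈ openConn o x).card ≠ (A.filter fun x => ω ∈ openConn q x).card :=
    fun ω h heq => absurd (heq ▸ h.1) (not_le.2 h.2)
  rw [sep_inter_eq_of_subset A o q hX, sep_inter_eq_of_subset A o q hY, sep_inter_eq_of_subset A o q hX',
    sep_inter_eq_of_subset A o q hY'] at key
  exact key

/-- **Deficiency form of ROW-O.**  For any vertices `o, q`, finite `S`, relays `A`, level `j`: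
`μ(o ↔ S, N ≤ j) − μ(o ↔ S, M_q ≤ j) ≤ (μ(N ≤ j) − μ(M_q ≤ j))⁺`. -/
theorem attachedSet_sub_le (w : Sym2 (Fin n) → unitInterval) (A S : Finset (Fin n)) (o q : Fin n) (j : ℕ) :
    (prodBernoulli w).real ((⋃ a ∈ S, (openConn o a : Set (BondConfig (Fin n)))) ∩
        {ω | (A.filter fun x => ω ∈ openConn o x).card ≤ j}) -
      (prodBernoulli w).real ((⋃ a ∈ S, (openConn o a : Set (BondConfig (Fin n)))) ∩
        {ω | (A.filter fun x => ω ∈ openConn q x).card ≤ j}) ≤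
    max 0 ((prodBernoulli w).real {ω : BondConfig (Fin n) | (A.filter fun x => ω ∈ openConn o x).card ≤ j} -
      (prodBernoulli w).real {ω : BondConfig (Fin n) | (A.filter fun x => ω ∈ openConn q x).card ≤ j}) := by
  set μ := prodBernoulli w with hμ
  set E : Set (BondConfig (Fin n)) := ⋃ a ∈ S, (openConn o a : Set (BondConfig (Fin n))) with hE
  set Ro : Set (BondConfig (Fin n)) := {ω | (A.filter fun x => ω ∈ openConn o x).card ≤ j} with hRo
  set Rq : Set (BondConfig (Fin n)) := {ω | (A.filter fun x => ω ∈ openConn q x).card ≤ j} with hRq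
  set X : Set (BondConfig (Fin n)) := {ω | (A.filter fun x => ω ∈ openConn o x).card ≤ j ∧
    j < (A.filter fun x => ω ∈ openConn q x).card} with hX
  set Y : Set (BondConfig (Fin n)) := {ω | j < (A.filter fun x => ω ∈ openConn o x).card ∧
    (A.filter fun x => ω ∈ openConn q x).card ≤ j} with hY
  have hmeas : ∀ s : Set (BondConfig (Fin n)), MeasurableSet s := fun _ => MeasurableSet.of_discrete
  have hsb : μ.real (E ∩ Ro) = μ.real ((E ∩ Ro) ∩ Rq) + μ.real ((E ∩ Ro) \ Rq) :=
    (measureReal_inter_add_sdiff (μ := μ) (s := E ∩ Ro) (t := Rq) (hmeas Rq)).symm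
  have hsq : μ.real (E ∩ Rq) = μ.real ((E ∩ Rq) ∩ Ro) + μ.real ((E ∩ Rq) \ Ro) :=
    (measureReal_inter_add_sdiff (μ := μ) (s := E ∩ Rq) (t := Ro) (hmeas Ro)).symm
  rw [light_sdiff_light_eq A o q j E] at hsb
  rw [light_sdiff_light_eq A q o j E, ← light_inter_light_comm A o q j E] at hsq
  have hub : μ.real (univ ∩ Ro) = μ.real ((univ ∩ Ro) ∩ Rq) + μ.real ((univ ∩ Ro) \ Rq) :=
    (measureReal_inter_add_sdiff (μ := μ) (s := univ ∩ Ro) (t := Rq) (hmeas Rq)).symm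
  have huq : μ.real (univ ∩ Rq) = μ.real ((univ ∩ Rq) ∩ Ro) + μ.real ((univ ∩ Rq) \ Ro) :=
    (measureReal_inter_add_sdiff (μ := μ) (s := univ ∩ Rq) (t := Ro) (hmeas Ro)).symm
  rw [light_sdiff_light_eq A o q j univ] at hub
  rw [light_sdiff_light_eq A q o j univ, ← light_inter_light_comm A o q j univ] at huq
  simp only [univ_inter] at hub huq
  have hYeq : ∀ F : Set (BondConfig (Fin n)), F ∩ {ω : BondConfig (Fin n) |
      (A.filter fun x => ω ∈ openConn q x).card ≤ j ∧ j < (A.filter fun x => ω ∈ openConn o x).card} = F ∩ Y := by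
    intro F; ext ω; simp only [mem_inter_iff, mem_setOf_eq, hY]; tauto
  rw [hYeq E] at hsq
  have hYeq' : {ω : BondConfig (Fin n) | (A.filter fun x => ω ∈ openConn q x).card ≤ j ∧
      j < (A.filter fun x => ω ∈ openConn o x).card} = Y := by
    have := hYeq univ; simpa only [univ_inter] using this
  rw [hYeq'] at huq
  have hrow : μ.real (E ∩ X) * μ.real Y ≤ μ.real (E ∩ Y) * μ.real X := attachedSet_row w A S o q j
  have hEX : μ.real (E ∩ X) ≤ μ.real X := measureReal_mono inter_subset_right (measure_ne_top μ _)
  have hEY : μ.real (E ∩ Y) ≤ μ.real Y := measureReal_mono inter_subset_right (measure_ne_top μ _)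
  have hEXnn : 0 ≤ μ.real (E ∩ X) := measureReal_nonneg
  have hEYnn : 0 ≤ μ.real (E ∩ Y) := measureReal_nonneg
  have hgoal : μ.real (E ∩ X) - μ.real (E ∩ Y) ≤ max 0 (μ.real X - μ.real Y) := by
    by_cases hY0 : μ.real Y = 0
    · have h1 : μ.real (E ∩ Y) = 0 := le_antisymm (hEY.trans (le_of_eq hY0)) hEYnn
      rw [h1, hY0, sub_zero, sub_zero]
      exact hEX.trans (le_max_right _ _)
    · have hYpos : 0 < μ.real Y := lt_of_le_of_ne measureReal_nonneg (Ne.symm hY0)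
      by_cases hXY : μ.real X ≤ μ.real Y
      · have h2 : μ.real (E ∩ X) * μ.real Y ≤ μ.real (E ∩ Y) * μ.real Y :=
          hrow.trans (mul_le_mul_of_nonneg_left hXY hEYnn)
        have h3 := le_of_mul_le_mul_right h2 hYpos
        exact (sub_nonpos.2 h3).trans (le_max_left _ _)
      · have h4 : μ.real (E ∩ X) * μ.real Y ≤ (μ.real (E ∩ Y) + (μ.real X - μ.real Y)) * μ.real Y := by
          have : μ.real (E ∩ Y) * μ.real X ≤ (μ.real (E ∩ Y) + (μ.real X - μ.real Y)) * μ.real Y := by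
            nlinarith
          exact hrow.trans this
        have h5 := le_of_mul_le_mul_right h4 hYpos
        calc μ.real (E ∩ X) - μ.real (E ∩ Y) ≤ μ.real X - μ.real Y := by linarith
          _ ≤ max 0 (μ.real X - μ.real Y) := le_max_right _ _
  rw [hsb, hsq, hub, huq]
  have : μ.real (E ∩ Ro ∩ Rq) + μ.real (E ∩ X) - (μ.real (E ∩ Ro ∩ Rq) + μ.real (E ∩ Y)) =
      μ.real (E ∩ X) - μ.real (E ∩ Y) := by ring
  rw [this]
  have : μ.real (Ro ∩ Rq) + μ.real X - (μ.real (Ro ∩ Rq) + μ.real Y) = μ.real X - μ.real Y := by ring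
  rw [this]
  exact hgoal

/-- **Easy regime, set form**: if `μ(N ≤ j) ≤ μ(M_q ≤ j)` then `μ(o ↔ S, N ≤ j) ≤ μ(o ↔ S, M_q ≤ j)` for every finite `S`. -/
theorem attachedSet_le_of_notLonelier (w : Sym2 (Fin n) → unitInterval) (A S : Finset (Fin n)) (o q : Fin n)
    (j : ℕ)
    (h : (prodBernoulli w).real {ω : BondConfig (Fin n) | (A.filter fun x => ω ∈ openConn o x).card ≤ j} ≤
      (prodBernoulli w).real {ω : BondConfig (Fin n) | (A.filter fun x => ω ∈ openConn q x).card ≤ j}) :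
    (prodBernoulli w).real ((⋃ a ∈ S, (openConn o a : Set (BondConfig (Fin n)))) ∩
        {ω | (A.filter fun x => ω ∈ openConn o x).card ≤ j}) ≤
      (prodBernoulli w).real ((⋃ a ∈ S, (openConn o a : Set (BondConfig (Fin n)))) ∩
        {ω | (A.filter fun x => ω ∈ openConn q x).card ≤ j}) := by
  have key := attachedSet_sub_le w A S o q j
  have hmax : max 0 ((prodBernoulli w).real {ω : BondConfig (Fin n) | (A.filter fun x => ω ∈ openConn o x).card ≤ j} -
      (prodBernoulli w).real {ω : BondConfig (Fin n) | (A.filter fun x => ω ∈ openConn q x).card ≤ j}) = 0 :=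
    max_eq_left (by linarith)
  rw [hmax] at key
  linarith

end AttachedChampionNotLonelier

open AttachedChampionNotLonelier in
/-- **XZ in the easy regime (all hulls, all numbers of ports, no championship needed).**  For every finite weighted
graph, relays `A`, vertices `o, q` and level `j`: if `μ(N ≤ j) ≤ μ(M_q ≤ j)` (`N = |{a ∈ A : o ↔ a}|`; the observer is no
lonelier than `q`), then `μ(1 ≤ N ≤ j) ≤ μ(M_q ≤ j ∧ 1 ≤ N)` — the conclusion of the registered stub `stub_attachedChampion`
of crux `NoHeavyLowerTail` (stmt-CriticalPhenomena-4575).  Proof: `attachedSet_le_of_notLonelier` with `S = A`, since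
`{1 ≤ N} = {o ↔ A}`.  Consequently the hull-port residual is confined to the regime `μ(N ≤ j) > μ(M_q ≤ j)`. -/
theorem attachedChampion_of_notLonelier (w : Sym2 (Fin n) → unitInterval) (A : Finset (Fin n)) (o q : Fin n) (j : ℕ)
    (h : (prodBernoulli w).real {ω : BondConfig (Fin n) | (A.filter fun x => ω ∈ openConn o x).card ≤ j} ≤
      (prodBernoulli w).real {ω : BondConfig (Fin n) | (A.filter fun x => ω ∈ openConn q x).card ≤ j}) :
    (prodBernoulli w).real {ω : BondConfig (Fin n) |
        1 ≤ (A.filter fun x => ω ∈ openConn o x).card ∧ (A.filter fun x => ω ∈ openConn o x).card ≤ j} ≤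
      (prodBernoulli w).real {ω : BondConfig (Fin n) |
        (A.filter fun x => ω ∈ openConn q x).card ≤ j ∧ 1 ≤ (A.filter fun x => ω ∈ openConn o x).card} := by
  have key := attachedSet_le_of_notLonelier w A A o q j h
  have hatt : ∀ ω : BondConfig (Fin n), ω ∈ (⋃ a ∈ A, (openConn o a : Set (BondConfig (Fin n)))) ↔
      1 ≤ (A.filter fun x => ω ∈ openConn o x).card := by
    intro ω
    rw [Nat.one_le_iff_ne_zero, Ne, Finset.card_eq_zero, ← Ne, ← Finset.nonempty_iff_ne_empty,
      Finset.filter_nonempty_iff, mem_iUnion₂]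
    simp only [exists_prop]
  have e1 : ((⋃ a ∈ A, (openConn o a : Set (BondConfig (Fin n)))) ∩
      {ω | (A.filter fun x => ω ∈ openConn o x).card ≤ j}) =
      {ω : BondConfig (Fin n) | 1 ≤ (A.filter fun x => ω ∈ openConn o x).card ∧
        (A.filter fun x => ω ∈ openConn o x).card ≤ j} := by
    ext ω; simp only [mem_inter_iff, mem_setOf_eq, hatt ω]
  have e2 : ((⋃ a ∈ A, (openConn o a : Set (BondConfig (Fin n)))) ∩
      {ω | (A.filter fun x => ω ∈ openConn q x).card ≤ j}) =
      {ω : BondConfig (Fin n) | (A.filter fun x => ω ∈ openConn q x).card ≤ j ∧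
        1 ≤ (A.filter fun x => ω ∈ openConn o x).card} := by
    ext ω; simp only [mem_inter_iff, mem_setOf_eq, hatt ω]; tauto
  rw [e1, e2] at key
  exact key

end Summit.CriticalPhenomena.PercolationContinuityZ3.Theorems

end
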